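import Summits.BirchSwinnertonDyer.BirchSwinnertonDyer.Theorems.ThetaPartnerAtTwoSignedControlAtTwoShaTwoPrimaryFinite
import Literature.NumberTheory.EllipticCurves.PointDivisibilityProofs
import Literature.NumberTheory.EllipticCurves.IwasawaCoinvariantsRankProofs
import HarnessLib

set_option linter.dupNamespace false -- `…BirchSwinnertonDyer.BirchSwinnertonDyer…` is the cell's nested layout (D-0017)
set_option autoImplicit false

/-!
# `Ш²(K, E[p^∞])` is FINITE when `Sel_{p^∞}(E/K)` is finite — WITHOUT the hypothesis `E(K)[p] = 0`
# (Greenberg's Thm. 4.1 regime: `Sel_E(F)_p` finite, `E(F)_p` ARBITRARY; LNM 1716 §4, pp. 102–108 and p. 119)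

Seat `bsd-inputs-k4-p1` (gen 7; LADDER-BSD D-0154 KEY (147)(f) «prove the printed input», row 1 K4 INPUTS; Greenberg
1999), `--supports stmt-BirchSwinnertonDyer-20309`. THEOREMS ONLY (no definition, no named fact, no `sorry`). Part 1 of 2
(part 2, `PublishedInputsGreenbergShaTwoVanishingAnyTorsion`, draws the consequences `Ш² = 0`, DIV, no finite
`Λ`-submodule).

R. Greenberg, *Iwasawa theory for elliptic curves*, LNM 1716 (1999), §4. Theorem 4.1 (p. 102) assumes ONLY good
ordinary reduction above `p` and «`Sel_E(F)_p` is finite»; the rational torsion `E(F)_p` is arbitrary and enters the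
formula as `|E(F)_p|²` (Lemmas 4.3, 4.7). The proof of Lemma 4.7 (p. 108) uses the exact row
`H¹(F_Σ/F_∞, E[p^∞])^Γ → 𝒫_E^Σ(F_∞)^Γ → (Sel_E(F_∞)_p)_Γ → H¹(F_Σ/F_∞, E[p^∞])_Γ` and «In the appendix, we will give a
proof that the last term is zero» (p. 108; p. 119: «We must now explain why `H¹(F_Σ/F_∞, E[p^∞])_Γ` is zero, under the
hypotheses of theorem 4.1»). The K4 lineage of this cell proved that vanishing — in the form «DIV»: every class of
`H¹(Gal(K̄/K_∞), E[p^∞])` is `conj_γ t − t` — through `Ш²(K, E[p^∞]) = 0` (w2's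
`ThetaPartnerAtTwoSignedControlAtTwoShaTwoPrimaryFinite`, this lineage's `…ShaTwoPrimaryVanishing{Odd,TotallyComplex}`,
`…DivOfShaTwoAnyField`, `…NoFiniteSubmoduleOfShaTwo`, `…ShaTwoVanishingHolds`), but ONLY under the extra hypothesis
`E(K)[p] = 0` (`E[p^∞]^{Γ_K} = 0`), which Theorem 4.1 does not make and which fails exactly in the Eisenstein cases
`p = 3, 5, 7` (and the `2`-adic reducible block) that the open case of the named fact `greenberg_charValue_rankZero`
(gen 6 memo `K4P1-GREENBERG-THM41-SIZING-UPDATE-G6.md`, item 1) is about.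

That hypothesis entered at ONE point: the bound `#Ш¹(K, E[p^k]) ≤ #Sel_{p^∞}(E/K)` (w2's
`ShaTwo.natCard_sha_torsion_le_selmerGroupPInfty`) used the INJECTIVITY of `H¹(K, E[p^k]) → H¹(K, E[p^∞])`, which holds
iff `E[p^∞]^{Γ_K} = 0`. In general the kernel of that map is the Kummer image of `E(K)[p^∞] = E[p^∞]^{Γ_K}`
(Greenberg §2 p. 63; the exact sequence `0 → E(K)[p^∞]/p^k → H¹(K, E[p^k]) → H¹(K, E[p^∞])[p^k] → 0`), a FINITE group
(Mordell–Weil), so the bound survives with the factor `#E[p^∞]^{Γ_K}`: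

* §1 (generic, any field `F`, the X11b `Levels` currency `i : A ↪ B`, `A = B[n]`, `B` `n`-divisible):
  `connectingClass_eq_of_nsmul_eq` (`δ(b)` depends only on `n • b`) and **`natCard_ker_map_one_le`**:
  `#ker(H¹(F, A) → H¹(F, B)) ≤ #B^{Γ_F}` when `B^{Γ_F}` is finite (the connecting map `B^{Γ_F} ↠ ker`).
* §2 (a number field `K`, `E = W` elliptic, any prime `p`, any `k`): `natCard_ker_map_primaryInclusion_le`
  (`#ker(H¹(K, E[p^k]) → H¹(K, E[p^∞])) ≤ #E[p^∞]^{Γ_K}`, finite by `finite_fixedPoints_geomPrimaryTorsion`);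
  **`finite_sha_torsion_and_natCard_le`**: `#Ш¹(K, E[p^k]) ≤ #E[p^∞]^{Γ_K} · #Sel_{p^∞}(E/K)` (NO torsion hypothesis);
  `finite_shaTwo_torsion_and_natCard_le`: the same bound for `#Ш²(K, E[p^k])` via Poitou–Tate (a) at level `p^k` and
  the Weil pairing (w2's route, `poitouTate_sha_tateDual K` taken by name).
* §3 **`finite_shaTwo_primary_and_natCard_le`**: `Ш²(K, E[p^∞])` is finite of order `≤ #E[p^∞]^{Γ_K} · #Sel_{p^∞}(E/K)`
  whenever `Sel_{p^∞}(E/K)` is finite (w2's assembly `exists_mem_shaTwo_map_primaryInclusion_eq` verbatim, new bound).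

HONEST FRAMING: §1 is generic Galois cohomology; §2–§3 re-run w2's `ShaTwoPrimaryFinite` with the torsion-tolerant
bound; `poitouTate_sha_tateDual K` (Milne I 4.10 (a)) enters BY NAME here (it is a tree theorem,
`SignedEC.PoitouTateShaRat.poitouTate_sha_tateDual_numberField`, discharged in part 2). Closes no item; no crux and no
summit statement is proved by this seat; the Birch–Swinnerton-Dyer conjecture is NOT proved by any of this.

References: [GreenbergLNM1716] §2 p. 63, §3 Lemma 3.1, §4 Thm. 4.1 (p. 102), Lemmas 4.3, 4.7 (pp. 103–108), p. 119;
[MilneADT2006] I Thm. 4.10 (a), §4 Lemma 4.8, §6; [SilvermanAEC2009] VIII §2, III.8.1, X.4.2;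
[SerreGaloisCohomology1997] I §2.2; [JetchevSkinnerWan2017] Lemma 3.3.3.
-/

noncomputable section

open scoped Classical NumberField ContRepresentation

namespace Summit.BirchSwinnertonDyer.BirchSwinnertonDyer.Theorems.InputsGreenbergShaTwoAnyTorsion

open CategoryTheory NumberField IsDedekindDomain Field Function WeierstrassCurve
open Literature.NumberTheory.EllipticCurves Literature.NumberTheory.GaloisRepresentations
open Literature.NumberTheory.GaloisRepresentations.DiscreteGaloisModule (sha shaTwo mem_sha_iff mem_shaTwo_iff tateDual)
open Literature.NumberTheory.GaloisCohomology
open Summit.BirchSwinnertonDyer.Rank1Residual.X11b (LocBridge.primaryGaloisModule)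
open Summit.BirchSwinnertonDyer.Rank1Residual.X11b.Levels
open Summit.BirchSwinnertonDyer.BirchSwinnertonDyer.Theorems.SignedEC

universe u

/-! ## §1 Generic: `δ(b)` depends only on `n • b`; `#ker(H¹(F, A) → H¹(F, B)) ≤ #B^{Γ_F}` -/

section Generic

variable {F : Type u} [Field F] {A B : Type u} [AddCommGroup A] [TopologicalSpace A]
  [DiscreteTopology A] [AddCommGroup B] [TopologicalSpace B] [DiscreteTopology B]
  {ρA : DiscreteGaloisModule F A} {ρB : DiscreteGaloisModule F B}
  {i : ρA.toContRepresentation →ⁱL ρB.toContRepresentation} {n : ℕ}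
  {hrange : ∀ b : B, n • b = 0 → ∃ a : A, i a = b}

/-- **The connecting class `δ(b) ∈ H¹(F, A)` of `b ∈ B` (with `n • b` invariant) depends only on `n • b`**: if
`n • b = n • b'` then `b - b' = i a` for some `a ∈ A` and the two lifted coboundary cocycles differ by the coboundary
of `a`. (The connecting HOMOMORPHISM `B^{Γ_F} → H¹(F, A)` of `0 → A → B →ⁿ B → 0` is well defined.)
[cite: SilvermanAEC2009, VIII §2] [cite: SerreGaloisCohomology1997, I §2.2] -/
theorem connectingClass_eq_of_nsmul_eq (hinj : Function.Injective i) (b b' : B)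
    (hb : ∀ σ : absoluteGaloisGroup F, ρB σ (n • b) = n • b)
    (hb' : ∀ σ : absoluteGaloisGroup F, ρB σ (n • b') = n • b') (h : n • b = n • b') :
    connectingClass i n hrange hinj b hb = connectingClass i n hrange hinj b' hb' := by
  obtain ⟨a, ha⟩ := hrange (b - b') (by rw [smul_sub, h, sub_self])
  -- the difference of the two lifted coboundary cocycles is the coboundary of `a = i⁻¹(b - b')`
  have h0 : oneCocycleClass ρA.toTopRep
      (liftCocycle i n hrange hinj (Summit.BirchSwinnertonDyer.Rank1Residual.X11b.Levels.cobCocycle ρB b) (nsmul_cobCocycle_apply_eq_zero n hb) -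
        liftCocycle i n hrange hinj (Summit.BirchSwinnertonDyer.Rank1Residual.X11b.Levels.cobCocycle ρB b') (nsmul_cobCocycle_apply_eq_zero n hb')) = 0 := by
    rw [oneCocycleClass_eq_zero_iff]
    refine ⟨a, fun σ ↦ hinj ?_⟩
    have e₁ := apply_liftCocycle (hrange := hrange) hinj (Summit.BirchSwinnertonDyer.Rank1Residual.X11b.Levels.cobCocycle ρB b) (nsmul_cobCocycle_apply_eq_zero n hb) σ
    have e₂ := apply_liftCocycle (hrange := hrange) hinj (Summit.BirchSwinnertonDyer.Rank1Residual.X11b.Levels.cobCocycle ρB b') (nsmul_cobCocycle_apply_eq_zero n hb') σ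
    rw [Summit.BirchSwinnertonDyer.Rank1Residual.X11b.Levels.cobCocycle_apply] at e₁ e₂
    have h' : i (ρA.toTopRep.ρ σ a) = ρB σ (i a) := i.isIntertwining σ a
    rw [Submodule.coe_sub, ContinuousMap.sub_apply, map_sub, e₁, e₂, map_sub, h', ha, map_sub]
    abel
  rw [oneCocycleClass_sub] at h0
  unfold connectingClass
  exact sub_eq_zero.mp h0

/-- **`#ker(H¹(F, A) → H¹(F, B)) ≤ #B^{Γ_F}`** for `i : A ↪ B` an injective intertwining map onto `B[n]` (`A` killed
by `n`, `B` `n`-divisible) with `B^{Γ_F}` finite: every class in the kernel is a connecting class `δ(b)` with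
`n • b ∈ B^{Γ_F}` (`Levels.map_one_eq_zero_iff_exists`), and `δ(b)` depends only on `n • b`
(`connectingClass_eq_of_nsmul_eq`), so `b₀ ↦ δ(b)` (`n • b = b₀`) maps `B^{Γ_F}` ONTO the kernel. This is the order
bound carried by the exact sequence `0 → B^{Γ_F}/n → H¹(F, A) → H¹(F, B)[n] → 0`.
[cite: GreenbergLNM1716, §2 p. 63] [cite: SilvermanAEC2009, VIII §2] -/
theorem natCard_ker_map_one_le (hrange : ∀ b : B, n • b = 0 → ∃ a : A, i a = b) (hinj : Function.Injective i)
    (hA : ∀ a : A, n • a = 0) (hdiv : ∀ b₀ : B, ∃ b : B, n • b = b₀)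
    (hfin : Set.Finite {b : B | ∀ σ : absoluteGaloisGroup F, ρB σ b = b}) :
    Finite {c : galoisCohomology ρA 1 // galoisCohomology.map i 1 c = 0} ∧
      Nat.card {c : galoisCohomology ρA 1 // galoisCohomology.map i 1 c = 0} ≤
        Nat.card {b : B | ∀ σ : absoluteGaloisGroup F, ρB σ b = b} := by
  haveI := hfin.to_subtype
  have hfix : ∀ b₀ : {b : B | ∀ σ : absoluteGaloisGroup F, ρB σ b = b}, ∀ σ : absoluteGaloisGroup F,
      ρB σ (n • Classical.choose (hdiv b₀.1)) = n • Classical.choose (hdiv b₀.1) := fun b₀ σ ↦ by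
    rw [Classical.choose_spec (hdiv b₀.1)]
    exact b₀.2 σ
  let G : {b : B | ∀ σ : absoluteGaloisGroup F, ρB σ b = b} →
      {c : galoisCohomology ρA 1 // galoisCohomology.map i 1 c = 0} := fun b₀ ↦
    ⟨connectingClass i n hrange hinj _ (hfix b₀), map_connectingClass hinj _ _⟩
  have hG : Function.Surjective G := by
    rintro ⟨c, hc⟩
    obtain ⟨b', hb', rfl⟩ := (map_one_eq_zero_iff_exists (hrange := hrange) hinj hA c).mp hc
    exact ⟨⟨n • b', hb'⟩, Subtype.ext
      (connectingClass_eq_of_nsmul_eq hinj _ b' (hfix ⟨n • b', hb'⟩) hb' (Classical.choose_spec (hdiv (n • b'))))⟩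
  exact ⟨Finite.of_surjective G hG, Nat.card_le_card_of_surjective G hG⟩

end Generic

/-! ## §2 `#Ш¹(K, E[p^k]) ≤ #E[p^∞]^{Γ_K} · #Sel_{p^∞}(E/K)` and the same for `Ш²`, with NO torsion hypothesis -/

section Bound

variable {K : Type} [Field K] [NumberField K] (W : WeierstrassCurve K) [W.IsElliptic] (p : ℕ) [hp : Fact p.Prime]

omit [NumberField K] [W.IsElliptic] hp in
/-- The `Γ_K`-fixed points of `E[p^∞]` in the `DiscreteGaloisModule` currency are the `Γ_K`-fixed points for the
action `σ • Q` (unfolding `LocBridge.primaryGaloisModule = ofSMul`). [folklore] -/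
theorem setOf_primaryGaloisModule_fixed_eq :
    {Q : W.geomPrimaryTorsion p | ∀ σ : absoluteGaloisGroup K, LocBridge.primaryGaloisModule W p σ Q = Q} =
      {Q : W.geomPrimaryTorsion p | ∀ σ : absoluteGaloisGroup K, σ • Q = Q} := by
  ext Q
  simp only [Set.mem_setOf_eq, LocBridge.primaryGaloisModule,
    Summit.BirchSwinnertonDyer.Rank1Residual.X11b.LocBridge.ofSMul_apply_apply]

/-- `E[p^∞]^{Γ_K}` (in the `DiscreteGaloisModule` currency) is finite: Galois descent to `E(K)_{tors}` and
Mordell–Weil (`finite_fixedPoints_geomPrimaryTorsion`). [cite: GreenbergLNM1716, §3 Lemma 3.1] -/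
theorem finite_setOf_primaryGaloisModule_fixed :
    Set.Finite {Q : W.geomPrimaryTorsion p |
      ∀ σ : absoluteGaloisGroup K, LocBridge.primaryGaloisModule W p σ Q = Q} := by
  rw [setOf_primaryGaloisModule_fixed_eq]
  exact W.finite_fixedPoints_geomPrimaryTorsion p

/-- **`#ker(H¹(K, E[p^k]) → H¹(K, E[p^∞])) ≤ #E[p^∞]^{Γ_K}`** (the kernel is the Kummer image of
`E(K)[p^∞] = E[p^∞]^{Γ_K}`, Greenberg §2 p. 63), finite for every number field `K`, elliptic `W/K`, prime `p` and
level `k` — §1 for `primaryInclusion W p k : E[p^k] ↪ E[p^∞]` (`E(K̄)` is divisible: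
`zsmul_geomPoints_surjective_holds`). [cite: GreenbergLNM1716, §2 p. 63] [cite: SilvermanAEC2009, VIII §2] -/
theorem natCard_ker_map_primaryInclusion_le (k : ℕ) :
    Finite {c : galoisCohomology (W.torsionGaloisModule ((p ^ k : ℕ) : ℤ)) 1 //
        galoisCohomology.map (primaryInclusion W p k) 1 c = 0} ∧
      Nat.card {c : galoisCohomology (W.torsionGaloisModule ((p ^ k : ℕ) : ℤ)) 1 //
          galoisCohomology.map (primaryInclusion W p k) 1 c = 0} ≤
        Nat.card {Q : W.geomPrimaryTorsion p |
          ∀ σ : absoluteGaloisGroup K, LocBridge.primaryGaloisModule W p σ Q = Q} :=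
  natCard_ker_map_one_le (exists_primaryInclusion_eq_of_nsmul_eq_zero W p k) (primaryInclusion_injective W p k) (pow_nsmul_geomTorsion_eq_zero W p k)
    (exists_pow_nsmul_eq_geomPrimaryTorsion W p k W.zsmul_geomPoints_surjective_holds)
    (finite_setOf_primaryGaloisModule_fixed W p)

/-- **`Ш¹(K, E[p^k])` is finite with `#Ш¹(K, E[p^k]) ≤ #E[p^∞]^{Γ_K} · #Sel_{p^∞}(E/K)`** when `Sel_{p^∞}(E/K)` is
finite — NO hypothesis on `E(K)[p]`: the homomorphism `Ш¹(K, E[p^k]) → Sel_{p^∞}(E/K)`, `x ↦ H¹(ι_k) x`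
(`ShaBound.map_mem_sha`, `ShaTwo.coe_mem_selmerGroupPInfty_of_mem_sha`) has kernel inside
`ker H¹(ι_k)`, of order `≤ #E[p^∞]^{Γ_K}` (`natCard_ker_map_primaryInclusion_le`), and image inside the finite Selmer
group. (w2's `ShaTwo.natCard_sha_torsion_le_selmerGroupPInfty` is the case `E[p^∞]^{Γ_K} = 0`.)
[cite: GreenbergLNM1716, §2 p. 63] [cite: MilneADT2006, Ch. I §6] -/
theorem finite_sha_torsion_and_natCard_le (k : ℕ) [Finite (W.selmerGroupPInfty p)] :
    Finite (sha (W.torsionGaloisModule ((p ^ k : ℕ) : ℤ))) ∧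
      Nat.card (sha (W.torsionGaloisModule ((p ^ k : ℕ) : ℤ))) ≤
        Nat.card {Q : W.geomPrimaryTorsion p |
            ∀ σ : absoluteGaloisGroup K, LocBridge.primaryGaloisModule W p σ Q = Q} *
          Nat.card (W.selmerGroupPInfty p) := by
  obtain ⟨hkfin, hkcard⟩ := natCard_ker_map_primaryInclusion_le W p k
  -- the homomorphism `Ш¹(K, E[p^k]) → Sel_{p^∞}(E/K)`
  let f : sha (W.torsionGaloisModule ((p ^ k : ℕ) : ℤ)) →+ W.selmerGroupPInfty p :=
    AddMonoidHom.codRestrict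
      ((galoisCohomology.map (primaryInclusion W p k) 1).comp (sha (W.torsionGaloisModule ((p ^ k : ℕ) : ℤ))).subtype)
      (W.selmerGroupPInfty p) fun x ↦
        ShaTwo.coe_mem_selmerGroupPInfty_of_mem_sha W p _
          (Summit.BirchSwinnertonDyer.Rank1Residual.X11b.ShaBound.map_mem_sha _ x.2)
  -- its kernel injects into `ker H¹(ι_k)`
  let g : f.ker → {c : galoisCohomology (W.torsionGaloisModule ((p ^ k : ℕ) : ℤ)) 1 //
      galoisCohomology.map (primaryInclusion W p k) 1 c = 0} := fun x ↦
    ⟨((x : sha (W.torsionGaloisModule ((p ^ k : ℕ) : ℤ))) : galoisCohomology _ 1), by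
      have hx := x.2
      rw [AddMonoidHom.mem_ker] at hx
      exact congrArg Subtype.val hx⟩
  have hg : Function.Injective g := fun x₁ x₂ h ↦ by
    have h' := congrArg Subtype.val h
    apply Subtype.ext
    apply Subtype.ext
    exact h'
  haveI := hkfin
  haveI : Finite f.ker := Finite.of_injective g hg
  have hker : Nat.card f.ker ≤ Nat.card {Q : W.geomPrimaryTorsion p |
      ∀ σ : absoluteGaloisGroup K, LocBridge.primaryGaloisModule W p σ Q = Q} :=
    (Nat.card_le_card_of_injective g hg).trans hkcard
  -- its image is finite
  haveI : Finite f.range := inferInstance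
  haveI : Finite (sha (W.torsionGaloisModule ((p ^ k : ℕ) : ℤ)) ⧸ f.ker) :=
    Finite.of_equiv _ (QuotientAddGroup.quotientKerEquivRange f).symm.toEquiv
  haveI hfin : Finite (sha (W.torsionGaloisModule ((p ^ k : ℕ) : ℤ))) := Finite.of_addSubgroup_quotient f.ker
  refine ⟨hfin, ?_⟩
  rw [AddSubgroup.card_eq_card_quotient_mul_card_addSubgroup f.ker,
    Nat.card_congr (QuotientAddGroup.quotientKerEquivRange f).toEquiv, mul_comm]
  exact Nat.mul_le_mul hker (AddSubgroup.card_le_card_addGroup f.range)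

/-- **`#Ш²(K, E[p^k]) ≤ #E[p^∞]^{Γ_K} · #Sel_{p^∞}(E/K)` for every `k ≥ 1`**, with NO hypothesis on `E(K)[p]`,
granted Poitou–Tate duality of `Ш` at the level `p^k` (`poitouTate_sha_tateDual K`, Milne I 4.10 (a)):
`#Ш²(K, E[p^k]) = #Ш¹(K, E[p^k]^D) ≤ #Ш¹(K, E[p^k])` (Weil pairing, w2/X11b `ShaBound`) and §2.
[cite: MilneADT2006, Ch. I, Thm. 4.10 (a)] [cite: SilvermanAEC2009, Prop. III.8.1] -/
theorem finite_shaTwo_torsion_and_natCard_le (hPT : poitouTate_sha_tateDual K) {k : ℕ} (hk : k ≠ 0)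
    [Finite (W.selmerGroupPInfty p)] :
    Finite (shaTwo (W.torsionGaloisModule ((p ^ k : ℕ) : ℤ))) ∧
      Nat.card (shaTwo (W.torsionGaloisModule ((p ^ k : ℕ) : ℤ))) ≤
        Nat.card {Q : W.geomPrimaryTorsion p |
            ∀ σ : absoluteGaloisGroup K, LocBridge.primaryGaloisModule W p σ Q = Q} *
          Nat.card (W.selmerGroupPInfty p) := by
  have hprime : p.Prime := hp.out
  haveI : NeZero (p ^ k) := ⟨pow_ne_zero k hprime.ne_zero⟩
  haveI : Finite (W.geomTorsion ((p ^ k : ℕ) : ℤ)) := finite_geomTorsion_of_neZero W (p ^ k)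
  have h2 : 2 ≤ p ^ k :=
    le_trans hprime.two_le (by simpa using Nat.pow_le_pow_right hprime.pos (Nat.one_le_iff_ne_zero.2 hk))
  obtain ⟨hfin2, -, hcard⟩ :=
    Summit.BirchSwinnertonDyer.Rank1Residual.X11b.ShaBound.natCard_shaTwo_eq_natCard_sha_tateDual
      hPT (p ^ k) (W.torsionGaloisModule ((p ^ k : ℕ) : ℤ)) (fun T ↦ AddSubgroup.torsionBy.nsmul T)
  obtain ⟨hfin1, hle⟩ := finite_sha_torsion_and_natCard_le W p k
  haveI := hfin1
  exact ⟨hfin2, hcard ▸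
    (Summit.BirchSwinnertonDyer.Rank1Residual.X11b.ShaBound.natCard_sha_tateDual_le W (p ^ k) h2).trans hle⟩

end Bound

/-! ## §3 `Ш²(K, E[p^∞])` is finite when `Sel_{p^∞}(E/K)` is finite — no torsion hypothesis -/

section Global

variable {K : Type} [Field K] [NumberField K] (W : WeierstrassCurve K) [W.IsElliptic] (p : ℕ) [hp : Fact p.Prime]

/-- **`Ш²(K, E[p^∞])` is finite, of order `≤ #E[p^∞]^{Γ_K} · #Sel_{p^∞}(E/K)`**, for every number field `K`, every
prime `p` and every elliptic `W/K` with `Sel_{p^∞}(E/K)` finite (NO hypothesis on `E(K)[p]`), granted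
`poitouTate_sha_tateDual K`: every finite set of classes of `Ш²(K, E[p^∞])` comes from ONE `Ш²(K, E[p^M])` (w2's
`ShaTwo.exists_mem_shaTwo_map_primaryInclusion_eq` + monotonicity), whose order is bounded by §2. The proof is w2's
`ShaTwo.finite_shaTwo_primary_and_natCard_le` with the new level bound.
[cite: MilneADT2006, Ch. I, Thm. 4.10 (a), §4 Lemma 4.8] [cite: GreenbergLNM1716, §2 p. 63] -/
theorem finite_shaTwo_primary_and_natCard_le (hPT : poitouTate_sha_tateDual K) [Finite (W.selmerGroupPInfty p)] :
    Finite (shaTwo (LocBridge.primaryGaloisModule W p)) ∧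
      Nat.card (shaTwo (LocBridge.primaryGaloisModule W p)) ≤
        Nat.card {Q : W.geomPrimaryTorsion p |
            ∀ σ : absoluteGaloisGroup K, LocBridge.primaryGaloisModule W p σ Q = Q} *
          Nat.card (W.selmerGroupPInfty p) := by
  set B : ℕ := Nat.card {Q : W.geomPrimaryTorsion p |
      ∀ σ : absoluteGaloisGroup K, LocBridge.primaryGaloisModule W p σ Q = Q} *
    Nat.card (W.selmerGroupPInfty p) with hB
  -- every finite set of classes of `Ш²(K, E[p^∞])` has at most `B` elements
  have key : ∀ s : Finset (galoisCohomology (LocBridge.primaryGaloisModule W p) 2),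
      (∀ Z ∈ s, Z ∈ shaTwo (LocBridge.primaryGaloisModule W p)) → s.card ≤ B := by
    intro s hs
    choose M hM0 z hzsha hz using fun Z : shaTwo (LocBridge.primaryGaloisModule W p) ↦
      ShaTwo.exists_mem_shaTwo_map_primaryInclusion_eq W p Z.1 Z.2
    set L : ℕ := (s.attach.image fun Z ↦ M ⟨Z.1, hs Z.1 Z.2⟩).sup id + 1 with hL
    have hML : ∀ (Z) (hZ : Z ∈ s), M ⟨Z, hs Z hZ⟩ ≤ L := fun Z hZ ↦ by
      have : M ⟨Z, hs Z hZ⟩ ∈ s.attach.image fun Z ↦ M ⟨Z.1, hs Z.1 Z.2⟩ :=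
        Finset.mem_image.mpr ⟨⟨Z, hZ⟩, Finset.mem_attach _ _, rfl⟩
      exact (Finset.le_sup (f := id) this).trans (Nat.le_succ _)
    obtain ⟨hfinL, hcardL⟩ := finite_shaTwo_torsion_and_natCard_le W p hPT (Nat.succ_ne_zero _) (k := L)
    haveI := hfinL
    haveI := Fintype.ofFinite (shaTwo (W.torsionGaloisModule ((p ^ L : ℕ) : ℤ)))
    let g : shaTwo (W.torsionGaloisModule ((p ^ L : ℕ) : ℤ)) → galoisCohomology (LocBridge.primaryGaloisModule W p) 2 :=
      fun y ↦ galoisCohomology.map (primaryInclusion W p L) 2 y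
    have hsub : s ⊆ Finset.univ.image g := by
      intro Z hZ
      rw [Finset.mem_image]
      refine ⟨⟨galoisCohomology.map (W.torsionInclusion
          (Summit.BirchSwinnertonDyer.Rank1Residual.X11b.WeakLeopoldt.pow_dvd_pow_cast p (hML Z hZ))) 2 (z ⟨Z, hs Z hZ⟩),
        ShaTwo.map_torsionInclusion_mem_shaTwo' W p (hML Z hZ) (hzsha ⟨Z, hs Z hZ⟩)⟩, Finset.mem_univ _, ?_⟩
      change galoisCohomology.map (primaryInclusion W p L) 2
        (galoisCohomology.map (W.torsionInclusion
          (Summit.BirchSwinnertonDyer.Rank1Residual.X11b.WeakLeopoldt.pow_dvd_pow_cast p (hML Z hZ))) 2 (z ⟨Z, hs Z hZ⟩)) = Z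
      rw [Summit.BirchSwinnertonDyer.Rank1Residual.X11b.WeakLeopoldt.map_primaryInclusion_map_torsionInclusion W p (hML Z hZ),
        hz]
    calc s.card ≤ (Finset.univ.image g).card := Finset.card_le_card hsub
      _ ≤ Finset.univ.card := Finset.card_image_le
      _ = Nat.card (shaTwo (W.torsionGaloisModule ((p ^ L : ℕ) : ℤ))) := by
          rw [Finset.card_univ, Nat.card_eq_fintype_card]
      _ ≤ B := hcardL
  -- finiteness
  have hfin : Finite (shaTwo (LocBridge.primaryGaloisModule W p)) := by
    by_contra hinf
    rw [not_finite_iff_infinite] at hinf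
    obtain ⟨t, -, ht⟩ := (Set.infinite_univ (α := shaTwo (LocBridge.primaryGaloisModule W p))).exists_subset_card_eq (B + 1)
    have h := key (t.map (Function.Embedding.subtype _)) (fun Z hZ ↦ by
      obtain ⟨Z', -, rfl⟩ := Finset.mem_map.mp hZ
      exact Z'.2)
    rw [Finset.card_map] at h
    omega
  refine ⟨hfin, ?_⟩
  haveI := Fintype.ofFinite (shaTwo (LocBridge.primaryGaloisModule W p))
  have h := key ((Finset.univ : Finset (shaTwo (LocBridge.primaryGaloisModule W p))).map (Function.Embedding.subtype _))
    (fun Z hZ ↦ by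
      obtain ⟨Z', -, rfl⟩ := Finset.mem_map.mp hZ
      exact Z'.2)
  rwa [Finset.card_map, Finset.card_univ, ← Nat.card_eq_fintype_card] at h

end Global

end Summit.BirchSwinnertonDyer.BirchSwinnertonDyer.Theorems.InputsGreenbergShaTwoAnyTorsion

end
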